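import Summits.BirchSwinnertonDyer.BirchSwinnertonDyer.Theorems.GenusKolyvaginAtTwoMinimalTwinBSDTwoKrizLiAnchor131a1
import Literature.NumberTheory.EllipticCurves.Curve37aRootNumber
import HarnessLib

/-!
# Route `GenusKolyvaginAtTwo`, crux U₂ `MinimalTwinBSDTwo` (stmt-BirchSwinnertonDyer-22985), LINE 23 «twin_swap»: THE ROOT NUMBER OF THE RANK-ONE ANCHOR `131a1`
# IS `−1` IN THE KERNEL (NON-split multiplicative reduction at every bad prime: `N = 131 = 131`), HENCE `ord_{s=1} L(131a1, s) = 1` MODULO MODULARITY +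
# Kriz–Li Thm 4.3 — the Gross–Zagier–Kolyvagin input (`rank_eq_analyticRank_of_analyticRank_le_one`) of the road `…KrizLiAnchor131a1.lean` DISCHARGED

Seat `bsd-line-gk2-p2` g36 (PROVER 2/3, cell `bsd-f1-sign2`; LINE 23 holder), `--supports stmt-BirchSwinnertonDyer-22985` (helper; closes nothing).
THEOREMS ONLY (0 `def`, 0 `sorry`); standard axioms.  HONEST FRAMING (D-0014/D-0036): method and lemma names of the tree's `Literature/…/Curve37aRootNumber.lean`
(non-split place) and of this seat's `…KrizLiAnchor43a1RootNumber.lean` (g36), transplanted to Cremona's `131A1` (`(⟨0, -1, 1, 1, 0⟩ : WeierstrassCurve ℚ)`, `Δ = -131`, `c₄ = -32`, `N = 131`):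
away from `131` the discriminant is a `v`-unit (good reduction, `W_v = +1`); at each place `v` above a bad prime `p ∈ {131}`, `c₄ = -32` is a `v`-unit and
`v(Δ) < 1` (multiplicative reduction), and the node-tangent quadratic `c₄T² + a₁c₄T − (54b₆ − 3b₂b₄ + a₂c₄) = -32T² − (110)` of the integral model has NO root in
`κ(O_v) = 𝔽_p` (a root `r` would make `(c₄r)² = c₄·(110) = -3520` a square mod `p`, but the Jacobi symbol `(-3520 | p) = −1` at every bad `p`) — NON-split, `W_p = +1`
(Rohrlich); so the algebraic root number `−∏_v W_v = −1`, and by the Modularity Theorem (`exists_isNewformOf`) with the tree's PROVED Atkin–Lehner comparison at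
squarefree conductor (`rootNumber_eq_algebraicRootNumber_of_squarefree`) `w(131a1) = −1`; parity (`odd_analyticRank_of_rootNumber_eq_neg_one`) makes `r_an` odd and
Kriz–Li Thm 4.3 with the Table-1 (★)-datum caps it at `1`: **`r_an(131a1) = 1`** with NO Gross–Zagier–Kolyvagin input (§3).  §4 re-issues the road theorems of
`…KrizLiAnchor131a1.lean` with `hmod` in place of `hGZK`.  **BSD is NOT proved by any of this; U₂ is NOT proved; the wall rows stay displayed; no item is closed.**

References: [CremonaAlgorithms1997] Table 1 (curve 131A1: `r = 1`), §2.11; [SilvermanAEC2009] VII.5 Prop. 5.1, C.16 Thm. 16.3; [Rohrlich1993Compositio] Prop. 2;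
[KrizLi2019] Thm 4.3, §6 Table 1 (row 131a1); [BCDTJAMS2001] Thm. A; [KellockDokchitser2023] Cor. 2.5.
-/

set_option autoImplicit false
-- the Theorems namespace of this sub repeats the summit name by design (D-0017 nested layout)
set_option linter.dupNamespace false

noncomputable section

open scoped Classical NumberField

open WeierstrassCurve IsDedekindDomain Rat.HeightOneSpectrum NumberField Literature.NumberTheory.EllipticCurves
  Literature.NumberTheory.EllipticCurves.ModularForms
  Literature.NumberTheory.EllipticCurves.Rank1Residual
  Literature.NumberTheory.EllipticCurves.Rank1Residual.Typed
  Literature.NumberTheory.DiophantineGeometry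
  Summit.BirchSwinnertonDyer
  Summit.BirchSwinnertonDyer.Rank1Residual
  Summit.BirchSwinnertonDyer.Rank1Residual.X11b
  Summit.BirchSwinnertonDyer.Rank1Residual.X5.O1
  Summit.BirchSwinnertonDyer.Rank1Residual.P2
  Summit.BirchSwinnertonDyer.BirchSwinnertonDyer.Rank1Residual.IntModel
  Summit.BirchSwinnertonDyer.BirchSwinnertonDyer.Theorems
  Summit.BirchSwinnertonDyer.BirchSwinnertonDyer.Theorems.AddPotGoodPrint
  Summit.BirchSwinnertonDyer.BirchSwinnertonDyer.Theorems.GenusExact.TwinSwap.KrizLiAnchorWall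
open IsDedekindDomain.HeightOneSpectrum Polynomial

namespace Summit.BirchSwinnertonDyer.BirchSwinnertonDyer.Theorems.GenusExact.TwinSwap.KrizLiAnchor131a1

/-! ## §1 Invariants of the equation over `ℚ` -/
section Invariants131A1RN

/-- `Δ(131a1) = -131` (rational model). [cite: CremonaAlgorithms1997, Table 1 (131A1)] -/
theorem Δ_131A1_rat : (⟨0, -1, 1, 1, 0⟩ : WeierstrassCurve ℚ).Δ = -131 := by
  norm_num [WeierstrassCurve.Δ, WeierstrassCurve.b₂, WeierstrassCurve.b₄, WeierstrassCurve.b₆, WeierstrassCurve.b₈]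

/-- `c₄(131a1) = -32` (rational model). [cite: CremonaAlgorithms1997, Table 1 (131A1)] -/
theorem c₄_131A1_rat : (⟨0, -1, 1, 1, 0⟩ : WeierstrassCurve ℚ).c₄ = -32 := by
  norm_num [WeierstrassCurve.c₄, WeierstrassCurve.b₂, WeierstrassCurve.b₄]

/-- `131a1` is integral at every finite place of `ℤ`. [cite: SilvermanAEC2009, VIII.8] -/
theorem isIntegralAt_131A1 (v : HeightOneSpectrum ℤ) : (⟨0, -1, 1, 1, 0⟩ : WeierstrassCurve ℚ).IsIntegralAt v := by
  rw [isIntegralAt_iff_valuation_le_one]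
  refine ⟨?_, ?_, ?_, ?_, ?_⟩
  · simp
  · simp
  · simp
  · simp
  · simp

end Invariants131A1RN

/-! ## §2 Local root numbers: `+1` everywhere (good away from `131`, NON-split multiplicative above each bad prime); algebraic root number `−1` -/
section LocalRootNumbers131A1

/-- At a place `v` with `v(Δ) = 1` (`v ∤ 131`) the curve has good reduction, so `W_v = 1`. [cite: Rohrlich1993Compositio, Prop. 2(i)] -/
theorem localRootNumberAt_of_valuation_Δ_eq_one_131A1 (v : HeightOneSpectrum ℤ)
    (h : v.valuation ℚ (⟨0, -1, 1, 1, 0⟩ : WeierstrassCurve ℚ).Δ = 1) :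
    haveI := isElliptic_131A1
    (⟨0, -1, 1, 1, 0⟩ : WeierstrassCurve ℚ).localRootNumberAt v = 1 :=
  haveI := isElliptic_131A1
  WeierstrassCurve.localRootNumberAt_of_hasGoodReductionAt
    (hasGoodReductionAt_of_valuation_Δ_eq_one_holds v _ (isIntegralAt_131A1 v) h)

/-- If `v(Δ) < 1` then `v` is the place above `131`: `131 ∈ v` (`Δ = -131`). [folklore] -/
theorem mem_of_valuation_Δ_lt_one_131A1 {v : HeightOneSpectrum ℤ}
    (h : v.valuation ℚ (⟨0, -1, 1, 1, 0⟩ : WeierstrassCurve ℚ).Δ < 1) : (131 : ℤ) ∈ v.asIdeal := by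
  rw [Δ_131A1_rat] at h
  have h' : v.valuation ℚ (algebraMap ℤ ℚ 131) < 1 := by
    have : (-131 : ℚ) = -(algebraMap ℤ ℚ 131) := by norm_num
    rw [this, Valuation.map_neg] at h
    exact h
  exact (v.valuation_lt_one_iff_mem (131 : ℤ)).mp h'

/-- At a place `v` with `32 ∉ v`, `c₄ = -32` is a `v`-unit. [cite: SilvermanAEC2009, VII.5 Prop. 5.1(b)] -/
theorem valuation_c₄_eq_one_131A1_of {v : HeightOneSpectrum ℤ} (hc : (32 : ℤ) ∉ v.asIdeal) :
    v.valuation ℚ (⟨0, -1, 1, 1, 0⟩ : WeierstrassCurve ℚ).c₄ = 1 := by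
  rw [c₄_131A1_rat]
  rw [show (-32 : ℚ) = -(algebraMap ℤ ℚ 32) by norm_num, Valuation.map_neg]
  by_contra h
  have hlt := lt_of_le_of_ne (v.valuation_le_one (32 : ℤ)) h
  exact hc ((v.valuation_lt_one_iff_mem (32 : ℤ)).mp hlt)

/-- `32 ∉ v` when `131 ∈ v` (Bezout: `(11)·131 + (-45)·32 = 1`). [folklore] -/
theorem not_mem_c₄_131A1_131 {v : HeightOneSpectrum ℤ} (hp : (131 : ℤ) ∈ v.asIdeal) :
    (32 : ℤ) ∉ v.asIdeal := by
  intro hc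
  have hone : (1 : ℤ) ∈ v.asIdeal := by
    have := v.asIdeal.add_mem (v.asIdeal.mul_mem_left (11) hp) (v.asIdeal.mul_mem_left (-45) hc)
    convert this using 1
    norm_num
  exact v.isPrime.ne_top ((Ideal.eq_top_iff_one _).mpr hone)

/-- At a place above `131`, `c₄ = -32` is a `v`-unit. [cite: SilvermanAEC2009, VII.5 Prop. 5.1(b)] -/
theorem valuation_c₄_eq_one_131A1_131 {v : HeightOneSpectrum ℤ} (hp : (131 : ℤ) ∈ v.asIdeal) :
    v.valuation ℚ (⟨0, -1, 1, 1, 0⟩ : WeierstrassCurve ℚ).c₄ = 1 :=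
  valuation_c₄_eq_one_131A1_of (not_mem_c₄_131A1_131 hp)

/-- The arithmetic heart at `131`: if `131 ∈ v` and `-32·r² − (110) ∈ v` for an integer `r`, then `-3520 = -32·(110) = (-32r)²` is a square in `ZMod 131` — impossible,
the Jacobi symbol `(-3520 | 131)` being `−1`. [folklore] -/
theorem no_int_root_131A1_131 {v : HeightOneSpectrum ℤ} (hp : (131 : ℤ) ∈ v.asIdeal) (r : ℤ)
    (hr : -32 * r ^ 2 + (-110) ∈ v.asIdeal) : False := by
  have hdvd : (131 : ℤ) ∣ -32 * r ^ 2 + (-110) := by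
    by_contra hnd
    have hP : Prime (131 : ℤ) := Int.prime_iff_natAbs_prime.mpr (by norm_num)
    obtain ⟨a, b, hab⟩ := (hP.coprime_iff_not_dvd).mpr hnd
    have hone : (1 : ℤ) ∈ v.asIdeal := by
      rw [← hab]
      exact v.asIdeal.add_mem (v.asIdeal.mul_mem_left a hp) (v.asIdeal.mul_mem_left b hr)
    exact v.isPrime.ne_top ((Ideal.eq_top_iff_one _).mpr hone)
  have hz : ((-32 * r ^ 2 + (-110) : ℤ) : ZMod 131) = 0 :=
    (ZMod.intCast_zmod_eq_zero_iff_dvd _ 131).mpr (by exact_mod_cast hdvd)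
  push_cast at hz
  have hsq : IsSquare ((-3520 : ℤ) : ZMod 131) := by
    refine ⟨((-32 * r : ℤ) : ZMod 131), ?_⟩
    push_cast
    linear_combination (32 : ZMod 131) * hz
  exact ZMod.nonsquare_of_jacobiSym_eq_neg_one (a := -3520) (b := 131) (by norm_num) hsq

/-- **The non-split mechanism for `131a1`**: at a place `v` where `c₄ = -32` is a unit and the integer quadratic `-32 r² − (110)` has no root modulo `v`, the chosen
local minimal model is NOT split multiplicative — the node-tangent quadratic `c₄T² + a₁c₄T − (54b₆ − 3b₂b₄ + a₂c₄) = -32 T² − (110)` of the integral model would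
have a root in `κ(O_v)`, which lifts to an integer root modulo `v`. [cite: CremonaAlgorithms1997, §2.11] [cite: SilvermanAEC2009, VII.5 Prop. 5.1(b)] -/
theorem not_hasSplitMultiplicativeReductionAt_131A1_of {v : HeightOneSpectrum ℤ} (hc : (32 : ℤ) ∉ v.asIdeal)
    (hroot : ∀ r : ℤ, (-32 * r ^ 2 + (-110) : ℤ) ∈ v.asIdeal → False) :
    haveI := isElliptic_131A1
    ¬ (⟨0, -1, 1, 1, 0⟩ : WeierstrassCurve ℚ).HasSplitMultiplicativeReductionAt v := by
  haveI := isElliptic_131A1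
  have hc₄ := valuation_c₄_eq_one_131A1_of hc
  have hW := isIntegralAt_131A1 v
  set O := v.adicCompletionIntegers ℚ with hO
  set K := v.adicCompletion ℚ with hK
  set EK := (⟨0, -1, 1, 1, 0⟩ : WeierstrassCurve ℚ).baseChange K with hEK
  haveI hmin : EK.IsMinimal O :=
    isMinimalAt_of_lt_valuation_c₄ hW
      (by rw [hc₄, ← WithZero.exp_zero]; exact WithZero.exp_lt_exp.mpr (by norm_num))
  haveI : EK.IsElliptic := by rw [hEK, WeierstrassCurve.baseChange]; infer_instance
  obtain ⟨Dv, hD⟩ : ∃ Dv : VariableChange K, (⟨0, -1, 1, 1, 0⟩ : WeierstrassCurve ℚ).localMinimalModel v = Dv • EK := ⟨_, rfl⟩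
  unfold WeierstrassCurve.HasSplitMultiplicativeReductionAt
  rw [hasSplitMultiplicativeReduction_iff_of_isMinimal_of_eq_smul O hD EK.isUnit_Δ.ne_zero,
    hasSplitMultiplicativeReduction_iff]
  intro hS
  obtain ⟨hm, hsplit⟩ := hS
  -- the integral model of `EK = E ⊗ K_v` has the integer coefficients of `E`
  have inj := IsFractionRing.injective O K
  have hc4 : (EK.integralModel O).c₄ = -32 := inj <| by
    rw [integralModel_c₄_eq, map_neg, map_ofNat, hEK, WeierstrassCurve.baseChange, map_c₄]; rw [c₄_131A1_rat]; norm_num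
  have ha1 : (EK.integralModel O).a₁ = 0 := inj <| by
    rw [integralModel_a₁_eq, map_zero, hEK, WeierstrassCurve.baseChange, map_a₁]; simp
  have ha2 : (EK.integralModel O).a₂ = -1 := inj <| by
    rw [integralModel_a₂_eq, map_neg, map_one, hEK, WeierstrassCurve.baseChange, map_a₂]; norm_num
  have hb2 : (EK.integralModel O).b₂ = -4 := inj <| by
    rw [integralModel_b₂_eq, map_neg, map_ofNat, hEK, WeierstrassCurve.baseChange, map_b₂]; norm_num [WeierstrassCurve.b₂]
  have hb4 : (EK.integralModel O).b₄ = 2 := inj <| by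
    rw [integralModel_b₄_eq, map_ofNat, hEK, WeierstrassCurve.baseChange, map_b₄]; norm_num [WeierstrassCurve.b₄]
  have hb6 : (EK.integralModel O).b₆ = 1 := inj <| by
    rw [integralModel_b₆_eq, map_one, hEK, WeierstrassCurve.baseChange, map_b₆]; norm_num [WeierstrassCurve.b₆]
  rw [hc4, ha1, ha2, hb2, hb4, hb6] at hsplit
  -- the node-tangent quadratic over `κ(O_v)` is `-32 T² − (110)`
  set φ : O →+* IsLocalRing.ResidueField O := algebraMap O (IsLocalRing.ResidueField O) with hφ
  have hC4 : (-32 : IsLocalRing.ResidueField O) ≠ 0 := by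
    intro h0
    rw [neg_eq_zero] at h0
    have : ((IsLocalRing.residue O).comp (algebraMap ℤ O)) 32 = 0 := by
      rw [RingHom.comp_apply, map_ofNat, map_ofNat]; exact h0
    have hmem : (32 : ℤ) ∈ v.asIdeal := by
      rw [← ker_residue_comp_algebraMap ℚ v]; exact this
    exact hc hmem
  have hpoly : Polynomial.map φ (C (-32 : O) * X ^ 2 + C (0 * -32) * X - C (54 * 1 - 3 * -4 * 2 + -1 * -32)) =
      C (-32 : IsLocalRing.ResidueField O) * X ^ 2 + C (0 : IsLocalRing.ResidueField O) * X
        + C (-110 : IsLocalRing.ResidueField O) := by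
    simp only [Polynomial.map_sub, Polynomial.map_add, Polynomial.map_mul, Polynomial.map_pow, Polynomial.map_X, Polynomial.map_ofNat, Polynomial.map_zero, Polynomial.map_one, Polynomial.map_neg, map_mul, map_sub, map_add, map_ofNat, map_zero, map_one, map_neg]
    ring
  rw [hpoly] at hsplit
  have hdeg : (C (-32 : IsLocalRing.ResidueField O) * X ^ 2 + C (0 : IsLocalRing.ResidueField O) * X
        + C (-110 : IsLocalRing.ResidueField O)).degree ≠ 0 := by
    rw [degree_quadratic hC4]; decide
  obtain ⟨t, ht⟩ := hsplit.exists_eval_eq_zero hdeg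
  simp only [eval_add, eval_mul, eval_C, eval_pow, eval_X, zero_mul, add_zero] at ht
  -- lift the root to an integer
  obtain ⟨r, hr⟩ := residue_comp_algebraMap_surjective ℚ v t
  have hι : ((IsLocalRing.residue O).comp (algebraMap ℤ O)) (-32 * r ^ 2 + (-110)) = 0 := by
    rw [map_add, map_mul, map_pow, hr]
    simp only [map_neg, map_ofNat]
    linear_combination ht
  have hmem : (-32 * r ^ 2 + (-110) : ℤ) ∈ v.asIdeal := by
    rw [← ker_residue_comp_algebraMap ℚ v]; exact hι
  exact hroot r hmem

/-- **NON-split multiplicative reduction above `131`** (`a_131(131a1) = −1`): the quadratic `-32 T² − (110)` has no root mod `131` by the Jacobi symbol. [cite: CremonaAlgorithms1997, Table 1 (131A1)] -/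
theorem not_hasSplitMultiplicativeReductionAt_131A1_131 {v : HeightOneSpectrum ℤ} (hp : (131 : ℤ) ∈ v.asIdeal) :
    haveI := isElliptic_131A1
    ¬ (⟨0, -1, 1, 1, 0⟩ : WeierstrassCurve ℚ).HasSplitMultiplicativeReductionAt v :=
  haveI := isElliptic_131A1
  not_hasSplitMultiplicativeReductionAt_131A1_of (not_mem_c₄_131A1_131 hp) (no_int_root_131A1_131 hp)

/-- At a place with `v(Δ) < 1`, `c₄` is a `v`-unit. [cite: SilvermanAEC2009, VII.5 Prop. 5.1(b)] -/
theorem valuation_c₄_eq_one_131A1 {v : HeightOneSpectrum ℤ} (h : v.valuation ℚ (⟨0, -1, 1, 1, 0⟩ : WeierstrassCurve ℚ).Δ < 1) :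
    v.valuation ℚ (⟨0, -1, 1, 1, 0⟩ : WeierstrassCurve ℚ).c₄ = 1 := by
  exact valuation_c₄_eq_one_131A1_131 (mem_of_valuation_Δ_lt_one_131A1 h)

/-- At a place with `v(Δ) < 1` the reduction is multiplicative (`v(c₄) = 1`). [cite: SilvermanAEC2009, VII.5 Prop. 5.1(b)] -/
theorem hasMultiplicativeReductionAt_131A1 {v : HeightOneSpectrum ℤ} (h : v.valuation ℚ (⟨0, -1, 1, 1, 0⟩ : WeierstrassCurve ℚ).Δ < 1) :
    haveI := isElliptic_131A1
    (⟨0, -1, 1, 1, 0⟩ : WeierstrassCurve ℚ).HasMultiplicativeReductionAt v :=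
  haveI := isElliptic_131A1
  hasMultiplicativeReductionAt_of_valuation_c₄_eq_one (isIntegralAt_131A1 v) (valuation_c₄_eq_one_131A1 h) h

/-- **NON-split multiplicative reduction at every bad place of `131a1`.** [cite: CremonaAlgorithms1997, Table 1 (131A1)] -/
theorem not_hasSplitMultiplicativeReductionAt_131A1 {v : HeightOneSpectrum ℤ} (h : v.valuation ℚ (⟨0, -1, 1, 1, 0⟩ : WeierstrassCurve ℚ).Δ < 1) :
    haveI := isElliptic_131A1
    ¬ (⟨0, -1, 1, 1, 0⟩ : WeierstrassCurve ℚ).HasSplitMultiplicativeReductionAt v := by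
  exact not_hasSplitMultiplicativeReductionAt_131A1_131 (mem_of_valuation_Δ_lt_one_131A1 h)

/-- **Every local root number of `131a1` is `+1`** (good reduction away from `131`, non-split multiplicative above it). [cite: Rohrlich1993Compositio, Prop. 2] -/
theorem localRootNumberAt_131A1 (v : HeightOneSpectrum ℤ) :
    haveI := isElliptic_131A1
    (⟨0, -1, 1, 1, 0⟩ : WeierstrassCurve ℚ).localRootNumberAt v = 1 := by
  haveI := isElliptic_131A1
  rcases (WeierstrassCurve.valuation_Δ_le_one_of_isIntegralAt (isIntegralAt_131A1 v)).eq_or_lt with h | h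
  · exact localRootNumberAt_of_valuation_Δ_eq_one_131A1 v h
  · exact localRootNumberAt_of_hasMultiplicativeReductionAt_of_not_split
      (hasMultiplicativeReductionAt_131A1 h) (not_hasSplitMultiplicativeReductionAt_131A1 h)

/-- **The algebraic root number of `131a1` is `−1`**: `−∏ᶠ_v W_v = −1`, all local factors being `+1` (Cremona Table 1: `131A1` has rank `1`, odd). [cite: CremonaAlgorithms1997, Table 1 (131A1)] -/
theorem algebraicRootNumber_131A1 :
    haveI := isElliptic_131A1
    (⟨0, -1, 1, 1, 0⟩ : WeierstrassCurve ℚ).algebraicRootNumber = -1 := by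
  haveI := isElliptic_131A1
  rw [WeierstrassCurve.algebraicRootNumber, finprod_eq_one_of_forall_eq_one localRootNumberAt_131A1]

end LocalRootNumbers131A1

/-! ## §3 Semistability, `w(131a1) = −1` from modularity, and `r_an(131a1) = 1` -/
section RootNumber131A1

/-- The conductor `N = 131` of `131a1` is squarefree. [cite: CremonaAlgorithms1997, Table 1 (131A1)] -/
theorem squarefree_conductorNorm_131A1 :
    haveI := isElliptic_131A1
    Squarefree ((⟨0, -1, 1, 1, 0⟩ : WeierstrassCurve ℚ).conductorNorm ℤ) := by
  rw [conductorNorm_131A1]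
  exact (show Nat.Prime 131 by norm_num).squarefree

/-- **`131a1` is semistable**: good or multiplicative reduction at every finite place. [cite: SilvermanAEC2009, VII.5 Prop. 5.1] -/
theorem isSemistable_131A1 : (⟨0, -1, 1, 1, 0⟩ : WeierstrassCurve ℚ).IsSemistable ℤ := by
  haveI := isElliptic_131A1
  intro v
  have hint := isIntegralAt_131A1 v
  rcases (WeierstrassCurve.valuation_Δ_le_one_of_isIntegralAt hint).eq_or_lt with h | h
  · exact WeierstrassCurve.isSemistableAt_of_valuation_Δ_eq_one hint h
  · exact WeierstrassCurve.isSemistableAt_of_valuation_c₄_eq_one hint (valuation_c₄_eq_one_131A1 h)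

/-- No place of additive reduction. [cite: SilvermanAEC2009, VII.5 Prop. 5.1] -/
theorem not_hasAdditiveReductionAt_131A1 (v : HeightOneSpectrum ℤ) :
    haveI := isElliptic_131A1
    ¬ (⟨0, -1, 1, 1, 0⟩ : WeierstrassCurve ℚ).HasAdditiveReductionAt v :=
  haveI := isElliptic_131A1
  (WeierstrassCurve.isSemistableAt_iff_not_hasAdditiveReductionAt v _).mp (isSemistable_131A1 v)

/-- **The (analytic) root number of `131a1` is `−1`, from the Modularity Theorem alone** (tree `rootNumber_eq_algebraicRootNumber_of_squarefree`, Atkin–Lehner at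
squarefree level). [cite: CremonaAlgorithms1997, Table 1 (131A1)] [cite: BCDTJAMS2001, Thm. A] [cite: KellockDokchitser2023, Cor. 2.5] -/
theorem rootNumber_131A1 (hmod : exists_isNewformOf) :
    haveI := isElliptic_131A1
    (⟨0, -1, 1, 1, 0⟩ : WeierstrassCurve ℚ).rootNumber = -1 := by
  haveI := isElliptic_131A1
  rw [(WeierstrassCurve.rootNumber_eq_algebraicRootNumber_of_squarefree _ squarefree_conductorNorm_131A1 hmod)
    (fun v h => (not_hasAdditiveReductionAt_131A1 v h).elim), algebraicRootNumber_131A1]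

/-- `ord_{s=1} L(131a1, s)` is odd, from the Modularity Theorem alone (`w = −1` and the unconditional half of parity). [cite: SilvermanAEC2009, C.16 Thm. 16.3 and remark, p. 451] -/
theorem odd_analyticRank_131A1 (hmod : exists_isNewformOf) :
    haveI := isElliptic_131A1
    Odd (⟨0, -1, 1, 1, 0⟩ : WeierstrassCurve ℚ).analyticRank :=
  haveI := isElliptic_131A1
  WeierstrassCurve.odd_analyticRank_of_rootNumber_eq_neg_one (rootNumber_131A1 hmod)

/-- ★ **`ord_{s=1} L(131a1, s) = 1` modulo PRINT + MODULARITY, with NO Gross–Zagier–Kolyvagin input**: odd by `w = −1` (`odd_analyticRank_131A1`) and `≤ 1` by Kriz–Li Thm 4.3 at `d = 1` with the Table-1 (★)-datum (`krizLi_analyticRank_le_one`).  Discharges the `hGZK` of `analyticRank_131A1`: Cremona's `r = 1` for `131A1` as a theorem modulo print + modularity. [cite: CremonaAlgorithms1997, Table 1 (131A1: r = 1)] [cite: KrizLi2019, Thm. 4.3 and §6 Table 1 (row 131a1)] -/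
theorem analyticRank_131A1_of_modularity (h33 : KrizLi2019.thm33_rank_twist) (htab : KrizLi2019.table1_row131a1)
    (hmod : exists_isNewformOf) :
    haveI := isElliptic_131A1
    (⟨0, -1, 1, 1, 0⟩ : WeierstrassCurve ℚ).analyticRank = 1 := by
  haveI := isElliptic_131A1; haveI := isGloballyMinimal_131A1
  haveI : Fact ((-23 : ℤ) < 0) := ⟨by norm_num⟩
  obtain ⟨hIQ, hdisc⟩ := P2.isImaginaryQuadratic_and_discr_of_sq_eq_neg_prime (sqrtField.finrank_eq_two (-23))
    (p := 23) (by norm_num) (by norm_num) (x := sqrtField.r (-23)) (by rw [sqrtField.r_sq']; push_cast; ring)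
  obtain ⟨_, Dt, H, ι, P, j, -, hP, hstar⟩ := htab (sqrtField (-23)) hIQ hdisc
  have hle := krizLi_analyticRank_le_one _ h33 twoTorsion_131A1 (sqrtField (-23)) hIQ (satisfiesHeegnerHypothesis_131A1 hIQ.1 hdisc)
    Dt H ι P hP j hstar
  obtain ⟨k, hk⟩ := odd_analyticRank_131A1 hmod
  omega

end RootNumber131A1

/-! ## §4 The road theorems of `…KrizLiAnchor131a1.lean` with GZK DISCHARGED (`hmod` in place of `hGZK`) -/
section Roads131A1OfModularity

/-- (GZK DISCHARGED: `hmod` = the Modularity Theorem `exists_isNewformOf` replaces `hGZK`; `r_an = 1` from the root number.) ★ **`BSD(W′, 2)` at EVERY global minimal `W′ ≅ 131a1^{(d)}` or `≅ 131a1^{(-23d)}`**, `d ∈ 𝒩(131a1, K)`, `χ_d(−131) = 1`, from the Table-1 row, PRINT, and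
the WALL (S1′ displayed as `hS1`: `BSD₂` for every non-CM curve of analytic rank `0`).  [cite: KrizLi2019, Thm. 5.1 (2), Thm. 4.3, §6 Table 1 (row 131a1)]
[cite: CreutzMiller2012, Thm. 1.1] [cite: Miller2011LMS, Def. 1.1] -/
theorem krizLi_bsdp_two_of_twist_131A1_of_wall_of_modularity (hKL : KrizLi2019.thm112_bsdTwo_twist) (h33 : KrizLi2019.thm33_rank_twist)
    (htab : KrizLi2019.table1_row131a1) (hS31 : bsdTriple_of_analyticRank_le_one_of_conductor_lt)
    (hmod : exists_isNewformOf)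
    (hS1 : ∀ (W : WeierstrassCurve ℚ) [W.IsElliptic] [W.IsGloballyMinimal], ¬ W.HasCM → W.analyticRank = 0 → BSDp W 2)
    (K : Type) [Field K] [NumberField K] (hK : IsImaginaryQuadratic K) (hdK : NumberField.discr K = -23)
    {d : ℤ} (hd : haveI := isGloballyMinimal_131A1; KrizLi2019.InN (⟨0, -1, 1, 1, 0⟩ : WeierstrassCurve ℚ) K d)
    (hsign : haveI := isElliptic_131A1; Int.sign d * jacobiSym ((⟨0, -1, 1, 1, 0⟩ : WeierstrassCurve ℚ).conductorNorm ℤ) d.natAbs = 1)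
    (W' : WeierstrassCurve ℚ) [W'.IsElliptic] [W'.IsGloballyMinimal]
    (hW' : (∃ C : VariableChange ℚ, C • (⟨0, -1, 1, 1, 0⟩ : WeierstrassCurve ℚ).quadraticTwist (d : ℚ) = W') ∨
      (∃ C : VariableChange ℚ, C • (⟨0, -1, 1, 1, 0⟩ : WeierstrassCurve ℚ).quadraticTwist ((d * NumberField.discr K : ℤ) : ℚ) = W')) :
    BSDp W' 2 := by
  haveI := isElliptic_131A1; haveI := isGloballyMinimal_131A1
  obtain ⟨_, Dt, H, ι, P, j, -, hP, hstar⟩ := htab K hK hdK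
  exact krizLi_bsdp_two_of_twist_of_conductor_lt_of_wall _ hKL h33 hS31 hS1 conductorNorm_lt_5000_131A1 not_hasCM_131A1
    (analyticRank_131A1_of_modularity h33 htab hmod) twoTorsion_131A1 K hK (satisfiesHeegnerHypothesis_131A1 hK.1 hdK) Dt H ι P hP j hstar (krizLi_loc_131A1 Dt)
    hd hsign W' hW'

/-- (GZK DISCHARGED: `hmod` = the Modularity Theorem `exists_isNewformOf` replaces `hGZK`; `r_an = 1` from the root number.) **THE RANK-ONE MEMBERS `131a1^{(d)}` — U₂-CLASS CURVES SETTLED MODULO THE WALL + PRINT**: at every global minimal `W₁ ≅ 131a1^{(d)}` (`d ∈ 𝒩(131a1, K)`,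
`χ_d(−131) = 1`): `r_an(W₁) = 1 ∧ ¬CM ∧ BSD(W₁, 2)`.  BSD is not proved by any of this; U₂ is not proved.
[cite: KrizLi2019, Thm. 5.1 (2), Thm. 4.3, Thm. 1.4, §6 Table 1 (row 131a1)] [cite: CreutzMiller2012, Thm. 1.1] -/
theorem rankOneMembers_131A1_of_modularity (hKL : KrizLi2019.thm112_bsdTwo_twist) (h33 : KrizLi2019.thm33_rank_twist)
    (htab : KrizLi2019.table1_row131a1) (hS31 : bsdTriple_of_analyticRank_le_one_of_conductor_lt)
    (hmod : exists_isNewformOf)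
    (hS1 : ∀ (W : WeierstrassCurve ℚ) [W.IsElliptic] [W.IsGloballyMinimal], ¬ W.HasCM → W.analyticRank = 0 → BSDp W 2)
    (K : Type) [Field K] [NumberField K] (hK : IsImaginaryQuadratic K) (hdK : NumberField.discr K = -23)
    {d : ℤ} (hd : haveI := isGloballyMinimal_131A1; KrizLi2019.InN (⟨0, -1, 1, 1, 0⟩ : WeierstrassCurve ℚ) K d)
    (hsign : haveI := isElliptic_131A1; Int.sign d * jacobiSym ((⟨0, -1, 1, 1, 0⟩ : WeierstrassCurve ℚ).conductorNorm ℤ) d.natAbs = 1)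
    (W₁ : WeierstrassCurve ℚ) [W₁.IsElliptic] [W₁.IsGloballyMinimal]
    (hW₁ : ∃ C : VariableChange ℚ, C • (⟨0, -1, 1, 1, 0⟩ : WeierstrassCurve ℚ).quadraticTwist (d : ℚ) = W₁) :
    W₁.analyticRank = 1 ∧ ¬ W₁.HasCM ∧ BSDp W₁ 2 := by
  haveI := isElliptic_131A1; haveI := isGloballyMinimal_131A1
  obtain ⟨_, Dt, H, ι, P, j, -, hP, hstar⟩ := htab K hK hdK
  exact rankOneMembers_of_wall _ hKL h33 hS31 hS1 conductorNorm_lt_5000_131A1 not_hasCM_131A1 (analyticRank_131A1_of_modularity h33 htab hmod) twoTorsion_131A1 K hK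
    (satisfiesHeegnerHypothesis_131A1 hK.1 hdK) Dt H ι P hP j hstar (krizLi_loc_131A1 Dt) hd hsign W₁ hW₁

/-- (GZK DISCHARGED: `hmod` = the Modularity Theorem `exists_isNewformOf` replaces `hGZK`; `r_an = 1` from the root number.) **THE RANK-ZERO COMPANIONS `131a1^{(-23d)}` — WALL ROW-1 INSTANCES**: at every global minimal `W₂ ≅ 131a1^{(d·d_K)}` (`d ∈ 𝒩(131a1, K)`, `χ_d(−131) = 1`):
`r_an(W₂) = 0 ∧ ¬CM ∧ BSD(W₂, 2)` (the last granted the wall).  BSD is not proved by any of this.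
[cite: KrizLi2019, Thm. 5.1 (2), Thm. 4.3, §6 Table 1 (row 131a1)] [cite: CreutzMiller2012, Thm. 1.1] -/
theorem rankZeroCompanions_131A1_of_modularity (hKL : KrizLi2019.thm112_bsdTwo_twist) (h33 : KrizLi2019.thm33_rank_twist)
    (htab : KrizLi2019.table1_row131a1) (hS31 : bsdTriple_of_analyticRank_le_one_of_conductor_lt)
    (hmod : exists_isNewformOf)
    (hS1 : ∀ (W : WeierstrassCurve ℚ) [W.IsElliptic] [W.IsGloballyMinimal], ¬ W.HasCM → W.analyticRank = 0 → BSDp W 2)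
    (K : Type) [Field K] [NumberField K] (hK : IsImaginaryQuadratic K) (hdK : NumberField.discr K = -23)
    {d : ℤ} (hd : haveI := isGloballyMinimal_131A1; KrizLi2019.InN (⟨0, -1, 1, 1, 0⟩ : WeierstrassCurve ℚ) K d)
    (hsign : haveI := isElliptic_131A1; Int.sign d * jacobiSym ((⟨0, -1, 1, 1, 0⟩ : WeierstrassCurve ℚ).conductorNorm ℤ) d.natAbs = 1)
    (W₂ : WeierstrassCurve ℚ) [W₂.IsElliptic] [W₂.IsGloballyMinimal]
    (hW₂ : ∃ C : VariableChange ℚ, C • (⟨0, -1, 1, 1, 0⟩ : WeierstrassCurve ℚ).quadraticTwist ((d * NumberField.discr K : ℤ) : ℚ) = W₂) :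
    W₂.analyticRank = 0 ∧ ¬ W₂.HasCM ∧ BSDp W₂ 2 := by
  haveI := isElliptic_131A1; haveI := isGloballyMinimal_131A1
  obtain ⟨_, Dt, H, ι, P, j, -, hP, hstar⟩ := htab K hK hdK
  exact rankZeroCompanions_of_wall _ hKL h33 hS31 hS1 conductorNorm_lt_5000_131A1 not_hasCM_131A1 (analyticRank_131A1_of_modularity h33 htab hmod) twoTorsion_131A1 K hK
    (satisfiesHeegnerHypothesis_131A1 hK.1 hdK) Dt H ι P hP j hstar (krizLi_loc_131A1 Dt) hd hsign W₂ hW₂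

/-- (GZK DISCHARGED: `hmod` = the Modularity Theorem `exists_isNewformOf` replaces `hGZK`; `r_an = 1` from the root number.) **The rank-one member `131a1^{(-3)}`** (`N = 1179`): `r_an = 1 ∧ ¬CM ∧ BSD(·, 2)` at every global minimal model, modulo the WALL + PRINT — the
`131a1` road is not vacuous on the U₂ side. BSD is not proved by any of this. [cite: KrizLi2019, Thm. 5.1 (2), Thm. 4.3, §6 Table 1 (row 131a1)] [cite: CreutzMiller2012, Thm. 1.1] -/
theorem rankOneMember_witness_131A1_of_modularity (hKL : KrizLi2019.thm112_bsdTwo_twist) (h33 : KrizLi2019.thm33_rank_twist)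
    (htab : KrizLi2019.table1_row131a1) (hS31 : bsdTriple_of_analyticRank_le_one_of_conductor_lt)
    (hmod : exists_isNewformOf)
    (hS1 : ∀ (W : WeierstrassCurve ℚ) [W.IsElliptic] [W.IsGloballyMinimal], ¬ W.HasCM → W.analyticRank = 0 → BSDp W 2)
    (K : Type) [Field K] [NumberField K] (hK : IsImaginaryQuadratic K) (hdK : NumberField.discr K = -23)
    (W₁ : WeierstrassCurve ℚ) [W₁.IsElliptic] [W₁.IsGloballyMinimal]
    (hW₁ : ∃ C : VariableChange ℚ, C • (⟨0, -1, 1, 1, 0⟩ : WeierstrassCurve ℚ).quadraticTwist ((-3 : ℤ) : ℚ) = W₁) :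
    W₁.analyticRank = 1 ∧ ¬ W₁.HasCM ∧ BSDp W₁ 2 :=
  rankOneMembers_131A1_of_modularity hKL h33 htab hS31 hmod hS1 K hK hdK (inN_witness_131A1 hK.1 hdK) sign_witness_131A1 W₁ hW₁

end Roads131A1OfModularity

end Summit.BirchSwinnertonDyer.BirchSwinnertonDyer.Theorems.GenusExact.TwinSwap.KrizLiAnchor131a1

end
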